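import Mathlib.Dynamics.Flow
import Mathlib.Topology.Compactness.Compact
import Mathlib.Topology.MetricSpace.Bounded
import Mathlib.Topology.Order.Compact
import Mathlib.Analysis.Normed.Field.Basic
import Mathlib.Order.Zorn
import HarnessLib

/-!
# Syndetic sets, uniformly recurrent points, and Birkhoff's recurrence theorem

Topic `Literature/Dynamics/TopologicalDynamics`. The classical vocabulary of recurrence in
topological dynamics (Birkhoff 1927; Gottschalk–Hedlund 1955; Furstenberg 1981, Ch. 1 §4), for an
action `ϕ : G → X → X` of an additive (topological, commutative) monoid `G` of "times" on a
topological space `X`, given as a bare family of maps (so that the results apply verbatim to a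
Mathlib `Flow G X` through its coercion, to `AddAction` instances through `(· +ᵥ ·)`, and to
actions that are only defined set-theoretically, e.g. the Navier–Stokes scaling flow on fields):

* `IsSyndetic S` — a set of times `S ⊆ G` is **syndetic** (relatively dense, "with bounded gaps")
  if finitely many — in general: a compact set of — translates of `S` cover `G`
  (Furstenberg 1981, Ch. 1 §4, Def. 1.7; Petersen 1983, Ch. 4 §1); for `G = ℝ` this is Bohr's relative
  density: some `L > 0` such that every window `[a, a + L]` meets `S`
  (`isSyndetic_iff_exists_window`).
* `IsUniformlyRecurrentPt ϕ x` — `x` is **uniformly recurrent** (= "almost periodic" in the sense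
  of topological dynamics, Gottschalk–Hedlund) if for every neighbourhood `U` of `x` the set of
  return times `{t | ϕ t x ∈ U}` is syndetic (Furstenberg 1981, Ch. 1 §4, Def. 1.8).
* **Birkhoff's recurrence theorem** in its two usual halves:
  `isUniformlyRecurrentPt_of_mem_closure_orbit` — a point `x` of a compact invariant set `M` that
  lies in the orbit closure of every point of `M` (e.g. `M` minimal) is uniformly recurrent
  (Furstenberg 1981, Thm. 1.15 / Petersen 1983, Ch. 4, Thm. 1.2 (Gottschalk 1944), the finite
  subcover argument); and `exists_isUniformlyRecurrentPt` — every nonempty compact invariant set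
  carries a uniformly recurrent point (Furstenberg 1981, Thm. 1.16: Zorn's lemma produces a minimal
  closed invariant subset, to which the first half applies).

## Design notes

* Only SEPARATE continuity `∀ t, Continuous (ϕ t)` and the action law
  `ϕ (s + t) = ϕ s ∘ ϕ t` are used; neither joint continuity, nor `ϕ 0 = id`, nor any separation
  axiom on `X`, nor closedness of the compact set is needed (the Zorn argument runs over closed
  sets `C` of the ambient space with `ϕ t (C ∩ S) ⊆ C`).
* Commutativity of `G` enters only to write the syndetic cover on the side Furstenberg writes it
  (`g + k ∈ S`).
* Mathlib (this pin) has minimal ACTIONS (`AddAction.IsMinimal`, whole space) and `Flow`, but no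
  syndetic sets, no uniformly recurrent points and no minimal subsets (searched `syndetic`,
  `uniformlyRecurrent`, `almostPeriodic`, `IsMinimal`): nothing here duplicates Mathlib.
* What is NOT here: the converse, Furstenberg 1981, Thm. 1.17 (the orbit closure of a uniformly
  recurrent point of a compact Hausdorff system is minimal; its proof uses regularity of the phase
  space); minimality of systems/subsets as a named notion (Def. 1.9; Mathlib has
  `AddAction.IsMinimal` for the whole space); measurable / ergodic recurrence.

## References

* H. Furstenberg, *Recurrence in Ergodic Theory and Combinatorial Number Theory*, Princeton UP
  (1981), Ch. 1 §4: Def. 1.7 (syndetic), Def. 1.8 (uniformly recurrent), Lemma 1.14, Thm. 1.15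
  (points of minimal systems are uniformly recurrent), Thm. 1.16 (Birkhoff: a compact system has a
  uniformly recurrent point), Thm. 1.17 (converse).
* K. Petersen, *Ergodic Theory*, Cambridge UP (1983), Ch. 4 §1, Thm. 1.2 (Gottschalk 1944).
* G. D. Birkhoff, *Dynamical Systems*, AMS Colloq. Publ. 9 (1927), Ch. VII.
-/

open Set Filter Function
open scoped Topology

namespace Literature.Dynamics.TopologicalDynamics

variable {G : Type*} {X : Type*}

/-! ### Syndetic sets -/

section Syndetic

variable [Add G] [TopologicalSpace G]

/-- A set of times `S ⊆ G` is **syndetic** if there is a compact set `K ⊆ G` of "corrections"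
such that every `g : G` can be moved into `S` by adding some `k ∈ K`: `∀ g, ∃ k ∈ K, g + k ∈ S`
(equivalently, the translates `S - k`, `k ∈ K`, cover `G`). For discrete `G = ℕ, ℤ` compact means
finite ("bounded gaps"); for `G = ℝ` it means relatively dense in Bohr's sense
(`isSyndetic_iff_exists_window`). [cite: Furstenberg1981, Ch. 1 §4, Def. 1.7] -/
def IsSyndetic (S : Set G) : Prop :=
  ∃ K : Set G, IsCompact K ∧ ∀ g : G, ∃ k ∈ K, g + k ∈ S

/-- A superset of a syndetic set is syndetic. [folklore] -/
theorem IsSyndetic.mono {S T : Set G} (h : IsSyndetic S) (hST : S ⊆ T) : IsSyndetic T := by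
  obtain ⟨K, hK, hS⟩ := h
  exact ⟨K, hK, fun g => let ⟨k, hk, hgk⟩ := hS g; ⟨k, hk, hST hgk⟩⟩

/-- A set meeting every translate of a fixed FINITE set of corrections is syndetic (finite sets
are compact); this is the form in which syndetic sets arise from finite subcovers. [folklore] -/
theorem IsSyndetic.of_finset {S : Set G} (F : Finset G) (h : ∀ g : G, ∃ k ∈ F, g + k ∈ S) :
    IsSyndetic S :=
  ⟨F, F.finite_toSet.isCompact, fun g => let ⟨k, hk, hgk⟩ := h g; ⟨k, Finset.mem_coe.2 hk, hgk⟩⟩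

/-- The whole group of times is syndetic (as soon as there is a time at all). [folklore] -/
theorem isSyndetic_univ [Nonempty G] : IsSyndetic (univ : Set G) := by
  inhabit G
  exact ⟨{default}, isCompact_singleton, fun g => ⟨default, mem_singleton _, mem_univ _⟩⟩

/-- A syndetic set is nonempty (as soon as there is a time at all). [folklore] -/
theorem IsSyndetic.nonempty [Nonempty G] {S : Set G} (h : IsSyndetic S) : S.Nonempty := by
  inhabit G
  obtain ⟨K, -, hS⟩ := h
  obtain ⟨k, -, hk⟩ := hS default
  exact ⟨_, hk⟩

/-- The empty set is not syndetic (as soon as there is a time at all). [folklore] -/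
theorem not_isSyndetic_empty [Nonempty G] : ¬ IsSyndetic (∅ : Set G) :=
  fun h => Set.not_nonempty_empty h.nonempty

end Syndetic

/-- **Syndetic sets of reals are the relatively dense ones** (Bohr): `S ⊆ ℝ` is syndetic iff there
is `L > 0` such that every window `[a, a + L]` meets `S`. [cite: Furstenberg1981, Ch. 1 §4, Def. 1.7] -/
theorem isSyndetic_iff_exists_window {S : Set ℝ} :
    IsSyndetic S ↔ ∃ L : ℝ, 0 < L ∧ ∀ a : ℝ, ∃ s ∈ Icc a (a + L), s ∈ S := by
  constructor
  · rintro ⟨K, hK, hS⟩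
    obtain ⟨r, hr⟩ := hK.isBounded.subset_closedBall 0
    refine ⟨2 * |r| + 1, by positivity, fun a => ?_⟩
    obtain ⟨k, hk, hak⟩ := hS (a + |r|)
    have hk' : |k| ≤ |r| := by
      have := hr hk
      rw [Metric.mem_closedBall, dist_zero_right, Real.norm_eq_abs] at this
      exact this.trans (le_abs_self r)
    refine ⟨a + |r| + k, ⟨?_, ?_⟩, hak⟩
    · linarith [neg_abs_le k]
    · linarith [le_abs_self k]
  · rintro ⟨L, hL, hS⟩
    refine ⟨Icc 0 L, isCompact_Icc, fun g => ?_⟩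
    obtain ⟨s, hs, hsS⟩ := hS g
    refine ⟨s - g, ⟨by linarith [hs.1], by linarith [hs.2]⟩, ?_⟩
    rwa [add_sub_cancel]

/-! ### Uniformly recurrent points -/

section Recurrent

variable [Add G] [TopologicalSpace G] [TopologicalSpace X]

/-- A point `x` is **uniformly recurrent** for the action `ϕ : G → X → X` (Birkhoff: "recurrent";
Gottschalk–Hedlund: "almost periodic") if for every neighbourhood `U` of `x` the set of return
times `{t | ϕ t x ∈ U}` is syndetic. [cite: Furstenberg1981, Ch. 1 §4, Def. 1.8] -/
def IsUniformlyRecurrentPt (ϕ : G → X → X) (x : X) : Prop :=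
  ∀ U ∈ 𝓝 x, IsSyndetic {t : G | ϕ t x ∈ U}

/-- Unfolding `IsUniformlyRecurrentPt`. [folklore] -/
theorem isUniformlyRecurrentPt_iff {ϕ : G → X → X} {x : X} :
    IsUniformlyRecurrentPt ϕ x ↔ ∀ U ∈ 𝓝 x, IsSyndetic {t : G | ϕ t x ∈ U} :=
  Iff.rfl

/-- It suffices to test uniform recurrence on OPEN neighbourhoods. [folklore] -/
theorem isUniformlyRecurrentPt_iff_isOpen {ϕ : G → X → X} {x : X} :
    IsUniformlyRecurrentPt ϕ x ↔ ∀ U : Set X, IsOpen U → x ∈ U → IsSyndetic {t : G | ϕ t x ∈ U} := by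
  refine ⟨fun h U hU hx => h U (hU.mem_nhds hx), fun h U hU => ?_⟩
  obtain ⟨V, hVU, hV, hxV⟩ := mem_nhds_iff.1 hU
  exact (h V hV hxV).mono fun t ht => hVU ht

/-- A fixed point is uniformly recurrent (every time is a return time). [folklore] -/
theorem isUniformlyRecurrentPt_of_forall_eq [Nonempty G] {ϕ : G → X → X} {x : X}
    (h : ∀ t, ϕ t x = x) : IsUniformlyRecurrentPt ϕ x := by
  intro U hU
  have : {t : G | ϕ t x ∈ U} = univ := eq_univ_of_forall fun t => by
    simp only [mem_setOf_eq, h t]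
    exact mem_of_mem_nhds hU
  rw [this]
  exact isSyndetic_univ

end Recurrent

/-! ### Birkhoff's recurrence theorem -/

section Birkhoff

variable [AddCommMonoid G] [TopologicalSpace G] [TopologicalSpace X]

/-- **Points of minimal compact invariant sets are uniformly recurrent** (Birkhoff; Furstenberg
1981, Thm. 1.15; Petersen 1983, Ch. 4, Thm. 1.2, "⇐"): let `ϕ` act by continuous maps with
`ϕ (s + t) = ϕ s ∘ ϕ t`, let `M` be compact and invariant, `x ∈ M`, and suppose `x` lies in the
orbit closure of EVERY point of `M` (this holds when `M` is minimal). Then `x` is uniformly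
recurrent. Proof: for an open `U ∋ x`, `M ⊆ ⋃ₜ (ϕ t)⁻¹ U`; a finite subcover `t₁, …, tₙ` gives,
for every `g`, some `i` with `ϕ (g + tᵢ) x = ϕ tᵢ (ϕ g x) ∈ U`. [cite: Furstenberg1981, Ch. 1 §4, Thm. 1.15] -/
theorem isUniformlyRecurrentPt_of_mem_closure_orbit {ϕ : G → X → X}
    (hcont : ∀ t, Continuous (ϕ t)) (hadd : ∀ s t x, ϕ (s + t) x = ϕ s (ϕ t x))
    {M : Set X} (hM : IsCompact M) (hinv : ∀ t, MapsTo (ϕ t) M M) {x : X} (hx : x ∈ M)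
    (hdense : ∀ y ∈ M, x ∈ closure (range fun t => ϕ t y)) :
    IsUniformlyRecurrentPt ϕ x := by
  rw [isUniformlyRecurrentPt_iff_isOpen]
  intro U hU hxU
  -- `M` is covered by the open sets `(ϕ t)⁻¹ U`
  have hcover : M ⊆ ⋃ t : G, ϕ t ⁻¹' U := by
    intro y hy
    obtain ⟨z, hzU, ⟨t, rfl⟩⟩ := mem_closure_iff.1 (hdense y hy) U hU hxU
    exact mem_iUnion.2 ⟨t, hzU⟩
  obtain ⟨F, hF⟩ := hM.elim_finite_subcover (fun t : G => ϕ t ⁻¹' U)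
    (fun t => hU.preimage (hcont t)) hcover
  refine IsSyndetic.of_finset F fun g => ?_
  have hgx : ϕ g x ∈ M := hinv g hx
  obtain ⟨t, htF, ht⟩ : ∃ t ∈ F, ϕ g x ∈ ϕ t ⁻¹' U := by
    simpa only [mem_iUnion, exists_prop] using hF hgx
  refine ⟨t, htF, ?_⟩
  show ϕ (g + t) x ∈ U
  rw [add_comm, hadd]
  exact ht

omit [TopologicalSpace G] in
/-- The orbit closure of a point is mapped into itself by every `ϕ t` (separate continuity and
the action law suffice). [folklore] -/
theorem mapsTo_closure_orbit {ϕ : G → X → X}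
    (hcont : ∀ t, Continuous (ϕ t)) (hadd : ∀ s t x, ϕ (s + t) x = ϕ s (ϕ t x)) (t : G) (y : X) :
    MapsTo (ϕ t) (closure (range fun s => ϕ s y)) (closure (range fun s => ϕ s y)) := by
  have h1 : MapsTo (ϕ t) (range fun s => ϕ s y) (range fun s => ϕ s y) := by
    rintro _ ⟨s, rfl⟩
    exact ⟨t + s, (hadd t s y)⟩
  exact h1.closure (hcont t)

/-- **Existence of uniformly recurrent points** (Birkhoff; Furstenberg 1981, Thm. 1.16): every
nonempty compact invariant set `S` of an action by continuous maps with `ϕ (s + t) = ϕ s ∘ ϕ t`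
contains a uniformly recurrent point. Proof: by Zorn's lemma (chains of closed sets `C` with
`ϕ t (C ∩ S) ⊆ C` and `C ∩ S ≠ ∅` have nonempty intersection on the compact `S`) there is a
minimal such `C`; `M = C ∩ S` is compact, invariant, and contained in the orbit closure of each of
its points, so `isUniformlyRecurrentPt_of_mem_closure_orbit` applies. No separation axiom and no
closedness of `S` are needed. [cite: Furstenberg1981, Ch. 1 §4, Thm. 1.16] -/
theorem exists_isUniformlyRecurrentPt {ϕ : G → X → X}
    (hcont : ∀ t, Continuous (ϕ t)) (hadd : ∀ s t x, ϕ (s + t) x = ϕ s (ϕ t x))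
    {S : Set X} (hS : IsCompact S) (hne : S.Nonempty) (hinv : ∀ t, MapsTo (ϕ t) S S) :
    ∃ x ∈ S, IsUniformlyRecurrentPt ϕ x := by
  classical
  -- the Zorn family: closed sets meeting `S` in a nonempty, relatively invariant set
  set 𝓕 : Set (Set X) :=
    {C | IsClosed C ∧ (C ∩ S).Nonempty ∧ ∀ t, MapsTo (ϕ t) (C ∩ S) C} with h𝓕
  have huniv : (univ : Set X) ∈ 𝓕 := by
    refine ⟨isClosed_univ, by simpa using hne, fun t z _ => mem_univ _⟩
  -- chains have lower bounds
  have hchain : ∀ c ⊆ 𝓕, IsChain (· ⊆ ·) c → c.Nonempty → ∃ lb ∈ 𝓕, ∀ s ∈ c, lb ⊆ s := by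
    intro c hc𝓕 hchain hcne
    refine ⟨⋂₀ c, ⟨?_, ?_, ?_⟩, fun s hs => sInter_subset_of_mem hs⟩
    · exact isClosed_sInter fun C hC => (hc𝓕 hC).1
    · -- finite intersection property on the compact set `S`
      by_contra hempty
      rw [not_nonempty_iff_eq_empty] at hempty
      haveI : Nonempty c := hcne.to_subtype
      have hdir : Directed (· ⊇ ·) (fun C : c => (C : Set X)) := by
        rintro ⟨C₁, h₁⟩ ⟨C₂, h₂⟩
        rcases hchain.total h₁ h₂ with h | h
        · exact ⟨⟨C₁, h₁⟩, Subset.rfl, h⟩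
        · exact ⟨⟨C₂, h₂⟩, h, Subset.rfl⟩
      have hst : S ∩ ⋂ C : c, (C : Set X) = ∅ := by
        rw [← sInter_eq_iInter, inter_comm]
        exact hempty
      obtain ⟨⟨C, hC⟩, hCS⟩ := hS.elim_directed_family_closed (fun C : c => (C : Set X))
        (fun C => (hc𝓕 C.2).1) hst hdir
      have := (hc𝓕 hC).2.1
      rw [inter_comm, hCS] at this
      exact Set.not_nonempty_empty this
    · intro t z hz
      refine mem_sInter.2 fun C hC => (hc𝓕 hC).2.2 t ⟨?_, hz.2⟩
      exact mem_sInter.1 hz.1 C hC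
  obtain ⟨C, -, hCmin⟩ := zorn_superset_nonempty 𝓕 hchain univ huniv
  obtain ⟨hCcl, ⟨x, hx⟩, hCmaps⟩ := hCmin.prop
  -- `M = C ∩ S` is compact and invariant
  set M : Set X := C ∩ S with hM
  have hMc : IsCompact M := hS.inter_left hCcl
  have hMinv : ∀ t, MapsTo (ϕ t) M M := fun t z hz => ⟨hCmaps t hz, hinv t hz.2⟩
  -- minimality: `C` is contained in the orbit closure of every point of `M`
  have hdense : ∀ y ∈ M, x ∈ closure (range fun t => ϕ t y) := by
    intro y hy
    set C' : Set X := C ∩ closure (range fun t => ϕ t y) with hC'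
    have hC'𝓕 : C' ∈ 𝓕 := by
      refine ⟨hCcl.inter isClosed_closure, ⟨ϕ 0 y, ⟨hCmaps 0 hy, ?_⟩, hinv 0 hy.2⟩, ?_⟩
      · exact subset_closure ⟨0, rfl⟩
      · intro t z hz
        exact ⟨hCmaps t ⟨hz.1.1, hz.2⟩, mapsTo_closure_orbit hcont hadd t y hz.1.2⟩
    have hC'C : C' = C := hCmin.eq_of_subset hC'𝓕 inter_subset_left
    have hxC' : x ∈ C' := hC'C ▸ hx.1
    exact hxC'.2
  exact ⟨x, hx.2, isUniformlyRecurrentPt_of_mem_closure_orbit hcont hadd hMc hMinv hx hdense⟩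

/-- Uniform recurrence is read off the orbit: if the orbit of `x` stays in a set `S` on which the
topology is tested, only neighbourhoods matter — in particular a uniformly recurrent point of the
action restricted to an invariant SUBTYPE is uniformly recurrent in the ambient space. [folklore] -/
theorem IsUniformlyRecurrentPt.of_subtype {S : Set X} {ϕ : G → X → X} (hinv : ∀ t, MapsTo (ϕ t) S S)
    {x : S} (h : IsUniformlyRecurrentPt (fun t (y : S) => (⟨ϕ t y, hinv t y.2⟩ : S)) x) :
    IsUniformlyRecurrentPt ϕ (x : X) := by
  intro U hU
  have hU' : ((↑) : S → X) ⁻¹' U ∈ 𝓝 x := continuous_subtype_val.continuousAt hU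
  exact (h _ hU').mono fun t ht => ht

end Birkhoff

/-! ### Mathlib `Flow`s -/

section Flow

variable [AddCommMonoid G] [TopologicalSpace G] [TopologicalSpace X]

/-- **Birkhoff's recurrence theorem for a Mathlib `Flow`** (deliberate dot-notation extension of
Mathlib's `Flow`): a nonempty compact invariant set of a flow contains a uniformly recurrent
point. [cite: Furstenberg1981, Ch. 1 §4, Thm. 1.16] -/
theorem _root_.Flow.exists_isUniformlyRecurrentPt (ϕ : Flow G X) {S : Set X} (hS : IsCompact S)
    (hne : S.Nonempty) (hinv : IsInvariant ϕ S) :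
    ∃ x ∈ S, IsUniformlyRecurrentPt ϕ x :=
  Literature.Dynamics.TopologicalDynamics.exists_isUniformlyRecurrentPt
    (fun t => ϕ.continuous_toFun t) (fun s t x => ϕ.map_add s t x) hS hne hinv

/-- Points of a compact invariant set of a Mathlib `Flow` lying in every orbit closure (e.g. of a
minimal set) are uniformly recurrent (deliberate dot-notation extension of Mathlib's `Flow`). [cite: Furstenberg1981, Ch. 1 §4, Thm. 1.15] -/
theorem _root_.Flow.isUniformlyRecurrentPt_of_mem_closure_orbit (ϕ : Flow G X) {M : Set X}
    (hM : IsCompact M) (hinv : IsInvariant ϕ M) {x : X} (hx : x ∈ M)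
    (hdense : ∀ y ∈ M, x ∈ closure (ϕ.orbit y)) : IsUniformlyRecurrentPt ϕ x :=
  Literature.Dynamics.TopologicalDynamics.isUniformlyRecurrentPt_of_mem_closure_orbit
    (fun t => ϕ.continuous_toFun t) (fun s t x => ϕ.map_add s t x) hM hinv hx fun y hy => by
      simpa only [Flow.orbit_eq_range] using hdense y hy

/-- On a compact phase space every Mathlib `Flow` has a uniformly recurrent point (deliberate
dot-notation extension of Mathlib's `Flow`). [cite: Furstenberg1981, Ch. 1 §4, Thm. 1.16] -/
theorem _root_.Flow.exists_isUniformlyRecurrentPt_univ [CompactSpace X] [Nonempty X] (ϕ : Flow G X) :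
    ∃ x, IsUniformlyRecurrentPt ϕ x := by
  obtain ⟨x, -, hx⟩ := ϕ.exists_isUniformlyRecurrentPt isCompact_univ univ_nonempty
    (fun t => mapsTo_univ _ _)
  exact ⟨x, hx⟩

end Flow

end Literature.Dynamics.TopologicalDynamics
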